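import Literature.AnabelianGeometry.SemiGraphs.ProSigmaCompletionMalnormal
import Literature.AnabelianGeometry.SemiGraphs.ProSigmaCompletionSlim
import Literature.AnabelianGeometry.SemiGraphs.ProSigmaCompletionInjective
import Mathlib.GroupTheory.Perm.Fin
import HarnessLib

/-!
# The vertex group of the sliding-ray countermodel: a pro-`Σ` (e.g. free pro-`p`) completion of the free
# group on two letters is SLIM, and the closed procyclic subgroups of `a` and of `a·b^m` are MALNORMAL

Mochizuki, *Semi-graphs of anabelioids*, Publ. RIMS **42** (2006) [SemiAnbd], Def. 2.4 (iv) p. 26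
("estranged": `Π_b ∩ g Π_{b′} g⁻¹ = 1` for distinct branch cosets) and Theorem 3.7 (iii) pp. 40–41, whose
printed proof (p. 41 l. 19–21 "since the semi-graphs `𝔾_j` are all finite") covers FINITE `𝔾`
[cite: MochizukiSemiAnbd2006, Thm 3.7(iii) pp.40-41].  abc-iut cell, layer L3, FRONTIER programme
SUBDAG-REFUTE-F1732 «towards a kernel erratum for the ∀-countable reading of [SemiAnbd] Thm 3.7 (iii)
([IUTchI] Rmk 2.5.3); desk countermodel abc-iut-L3-d1 g3 memo 8b26b5199c29f55f (the sliding ray `𝒢_θ`: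
vertex groups the free pro-`p` group `G = ⟨a, b⟩`, edge groups `ℤ_p` glued by `1 ↦ a` and
`1 ↦ a·b^{p^{n_k}}`); print proves finite `𝔾` (kernel: p431007)» — brick **R2a** (seat abc-iut-L3-t7
gen 5): the vertex-group facts the hypotheses (H2) "verticially slim" and (H3) "totally estranged, SELF
terms" of `Thm37Hypotheses 𝒢_θ` (brick R5, abc-iut-w6-d102) consume BY NAME.

PROOF-ONLY file (no definition, no new named fact).  PRESEARCH outcome: no cite-tagged classical fact
(«centralisers in a free pro-`p` group are procyclic», [RibesZalesskii2010]) is needed — the tree's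
pro-`Σ` engine already proves, for EVERY pro-`Σ` completion `ι : Γ →* G` of a nonabelian free group
(`IsProSigmaCompletion Sigma ι`, abc-iut-L3-t1; `Σ = {p}` is the free pro-`p` case):
`IsProSigmaCompletion.isSlimGroup` (ProSigmaCompletionSlim.lean), and, for a free basis element `c`,
`IsProSigmaCompletion.mem_closure_zpowers_of_commute` / `….closure_zpowers_inf_conj_eq_bot`
(ProSigmaCompletionMalnormal.lean: centralisers of non-trivial elements of `cl ι⟨c⟩` lie in it;
malnormality).  In BINDER form over `(ι : FreeGroup (Fin 2) →* G) (hι : IsProSigmaCompletion Sigma ι)`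
(brick R1, abc-iut-w6-d019, supplies the datum at `Σ = {p}` with `a = ι (of 0)`, `b = ι (of 1)`):

* `FreeTwo.exists_freeGroupBasis_mul_zpow m` — the Nielsen move: `{of 0 · (of 1)^m, of 1}` is a free
  basis of `FreeGroup (Fin 2)`;
* (private helpers) `F₂` is nonabelian; `x₀ x₁^m ≠ 1`;
* `infinite_closure_zpowers_a hι hp`, `infinite_closure_zpowers_aMulPow hι hp m` — the branch subgroups
  are INFINITE (for `Σ` containing a prime; tree's `infinite_topologicalClosure_map_zpowers`) — the
  «infinite index» (`relIndex = 0`) clauses of `IsEstranged` via abc-iut-w6-d102's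
  `relIndex_eq_zero_of_inf_eq_bot_of_infinite`;
* `isSlimGroup_of_freeTwo hι : IsSlimGroup G` — (H2);
* `closure_zpowers_a_inf_conj_eq_bot hι hx : A ⊓ x • A = ⊥` for `x ∉ A := cl ⟨ι (of 0)⟩`, and
  `closure_zpowers_aMulPow_inf_conj_eq_bot hι m hx : A_m ⊓ x • A_m = ⊥` for
  `x ∉ A_m := cl ⟨ι (of 0 * of 1 ^ m)⟩` (take `m = p ^ n`) — the (H3) SELF terms; with the companion
  centraliser statements `mem_closure_zpowers_a_of_commute` / `…_aMulPow_of_commute`.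

The CROSS term `A ⊓ g • A_{p^n} = ⊥` (abelianisation) is brick R2b (abc-iut-w6-d096).  Classical
profinite group theory; nothing of [SemiAnbd] is asserted; desk ≠ kernel for `𝒢_θ` until R3–R7 land;
nothing here bears on [IUTchIII] Cor. 3.12.
-/

namespace Literature.AnabelianGeometry.SemiGraphs

open scoped Pointwise
open SemiGraphOfAnabelioids (IsProSigmaCompletion)

/-! ### The free group on two letters: a Nielsen basis and non-commutativity -/

namespace FreeTwo

/-- The Nielsen automorphism `of 0 ↦ of 0 · (of 1)^m`, `of 1 ↦ of 1` of `FreeGroup (Fin 2)`, as an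
existence statement of a free basis `{of 0 · (of 1)^m, of 1}` (no definition is introduced).
[cite: MagnusKarrassSolitar1966, §3.2 Nielsen transformations] -/
theorem exists_freeGroupBasis_mul_zpow (m : ℤ) :
    ∃ b : FreeGroupBasis (Fin 2) (FreeGroup (Fin 2)),
      b 0 = FreeGroup.of 0 * FreeGroup.of 1 ^ m ∧ b 1 = FreeGroup.of 1 := by
  -- the endomorphisms `φ : x₀ ↦ x₀ x₁^m, x₁ ↦ x₁` and `ψ : x₀ ↦ x₀ x₁^{-m}, x₁ ↦ x₁`
  let φ : FreeGroup (Fin 2) →* FreeGroup (Fin 2) :=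
    FreeGroup.lift ![FreeGroup.of 0 * FreeGroup.of 1 ^ m, FreeGroup.of 1]
  let ψ : FreeGroup (Fin 2) →* FreeGroup (Fin 2) :=
    FreeGroup.lift ![FreeGroup.of 0 * FreeGroup.of 1 ^ (-m), FreeGroup.of 1]
  have hφ0 : φ (FreeGroup.of 0) = FreeGroup.of 0 * FreeGroup.of 1 ^ m := by simp [φ]
  have hφ1 : φ (FreeGroup.of 1) = FreeGroup.of 1 := by simp [φ]
  have hψ0 : ψ (FreeGroup.of 0) = FreeGroup.of 0 * FreeGroup.of 1 ^ (-m) := by simp [ψ]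
  have hψ1 : ψ (FreeGroup.of 1) = FreeGroup.of 1 := by simp [ψ]
  have h1 : φ.comp ψ = MonoidHom.id _ := by
    refine FreeGroup.ext_hom _ _ (Fin.forall_fin_two.mpr ⟨?_, ?_⟩)
    · simp only [MonoidHom.coe_comp, Function.comp_apply, MonoidHom.id_apply]
      rw [hψ0, map_mul, map_zpow, hφ0, hφ1, mul_assoc, ← zpow_add, add_neg_cancel, zpow_zero,
        mul_one]
    · simp only [MonoidHom.coe_comp, Function.comp_apply, MonoidHom.id_apply]
      rw [hψ1, hφ1]
  have h2 : ψ.comp φ = MonoidHom.id _ := by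
    refine FreeGroup.ext_hom _ _ (Fin.forall_fin_two.mpr ⟨?_, ?_⟩)
    · simp only [MonoidHom.coe_comp, Function.comp_apply, MonoidHom.id_apply]
      rw [hφ0, map_mul, map_zpow, hψ0, hψ1, mul_assoc, ← zpow_add, neg_add_cancel, zpow_zero,
        mul_one]
    · simp only [MonoidHom.coe_comp, Function.comp_apply, MonoidHom.id_apply]
      rw [hφ1, hψ1]
  let θ : FreeGroup (Fin 2) ≃* FreeGroup (Fin 2) := MonoidHom.toMulEquiv φ ψ h2 h1
  refine ⟨(FreeGroupBasis.ofFreeGroup (Fin 2)).map θ, ?_, ?_⟩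
  · rw [FreeGroupBasis.map_apply, FreeGroupBasis.ofFreeGroup_apply]
    exact hφ0
  · rw [FreeGroupBasis.map_apply, FreeGroupBasis.ofFreeGroup_apply]
    exact hφ1

/-- The free group on two letters is nonabelian: `x₀ x₁ ≠ x₁ x₀` (map `x₀, x₁` to the transpositions
`(0 1)`, `(1 2)` of `Fin 3`). [folklore] -/
private theorem of_zero_mul_of_one_ne :
    (FreeGroup.of 0 * FreeGroup.of 1 : FreeGroup (Fin 2)) ≠ FreeGroup.of 1 * FreeGroup.of 0 := by
  intro h
  let f : FreeGroup (Fin 2) →* Equiv.Perm (Fin 3) :=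
    FreeGroup.lift ![Equiv.swap 0 1, Equiv.swap 1 2]
  have h' := congrArg f h
  simp only [map_mul, f, FreeGroup.lift_apply_of, Matrix.cons_val_zero, Matrix.cons_val_one] at h'
  exact absurd h' (by decide)

/-- Hence: some two elements of `FreeGroup (Fin 2)` do not commute (the hypothesis shape of
`IsProSigmaCompletion.isSlimGroup`). [folklore] -/
private theorem exists_mul_ne_mul : ∃ x y : FreeGroup (Fin 2), x * y ≠ y * x :=
  ⟨FreeGroup.of 0, FreeGroup.of 1, of_zero_mul_of_one_ne⟩

/-- `x₀ x₁^m ≠ 1` in `FreeGroup (Fin 2)` (it is a free basis element). [folklore] -/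
private theorem of_zero_mul_of_one_zpow_ne_one (m : ℤ) :
    (FreeGroup.of 0 * FreeGroup.of 1 ^ m : FreeGroup (Fin 2)) ≠ 1 := by
  obtain ⟨b, hb0, -⟩ := exists_freeGroupBasis_mul_zpow m
  rw [← hb0]
  intro h
  have h' := congrArg b.repr h
  rw [FreeGroupBasis.repr_apply_coe, map_one] at h'
  exact FreeGroup.of_ne_one _ h'

end FreeTwo

/-! ### (H2) and the (H3) self terms for a pro-`Σ` completion of `F₂`, in binder form -/

section Completion

variable {Sigma : Set ℕ} {G : Type*} [Group G] [TopologicalSpace G] [IsTopologicalGroup G]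
  [CompactSpace G] [TotallyDisconnectedSpace G] [T2Space G] {ι : FreeGroup (Fin 2) →* G}

/-- **(H2) for the vertex group of `𝒢_θ`**: every pro-`Σ` completion of the free group on two letters
(in particular the free pro-`p` group of rank `2`, `Σ = {p}`) is SLIM — by the tree's
`IsProSigmaCompletion.isSlimGroup` ([AbsAnab] Lem 1.3.1, affine case).
[cite: MochizukiAbsAnab2004, Lemma 1.3.1 p.15] -/
theorem isSlimGroup_of_freeTwo (hι : IsProSigmaCompletion Sigma ι) :
    Literature.AlgebraicGeometry.Frobenioids.IsSlimGroup G :=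
  IsProSigmaCompletion.isSlimGroup FreeTwo.exists_mul_ne_mul hι

omit [CompactSpace G] [TotallyDisconnectedSpace G] [T2Space G] in
/-- **The branch subgroup `A = cl ⟨a⟩` is infinite** (`Σ` containing a prime): `ι` is injective on the
free group and `of 0` has infinite order (tree's `infinite_topologicalClosure_map_zpowers`).
[cite: MochizukiSemiAnbd2006, Ex. 2.10 p.31] -/
theorem infinite_closure_zpowers_a (hι : IsProSigmaCompletion Sigma ι) (hp : ∃ p ∈ Sigma, p.Prime) :
    Infinite (Subgroup.zpowers (ι (FreeGroup.of 0))).topologicalClosure := by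
  have h := IsProSigmaCompletion.infinite_topologicalClosure_map_zpowers hι hp
    (FreeGroup.of_ne_one (0 : Fin 2))
  rwa [MonoidHom.map_zpowers] at h

omit [CompactSpace G] [TotallyDisconnectedSpace G] [T2Space G] in
/-- **The branch subgroup `A_m = cl ⟨a·b^m⟩` is infinite** (`Σ` containing a prime).
[cite: MochizukiSemiAnbd2006, Ex. 2.10 p.31] -/
theorem infinite_closure_zpowers_aMulPow (hι : IsProSigmaCompletion Sigma ι) (hp : ∃ p ∈ Sigma, p.Prime)
    (m : ℤ) :
    Infinite (Subgroup.zpowers (ι (FreeGroup.of 0 * FreeGroup.of 1 ^ m))).topologicalClosure := by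
  have h := IsProSigmaCompletion.infinite_topologicalClosure_map_zpowers hι hp
    (FreeTwo.of_zero_mul_of_one_zpow_ne_one m)
  rwa [MonoidHom.map_zpowers] at h

omit [T2Space G] in
/-- **Centraliser condition for `A = cl ⟨a⟩`, `a = ι (of 0)`**: an element of `G` commuting with some
`y ≠ 1` of `A` lies in `A`. [cite: MochizukiSemiAnbd2006, Ex. 2.10 p.31] -/
theorem mem_closure_zpowers_a_of_commute (hι : IsProSigmaCompletion Sigma ι) {x y : G}
    (hy : y ∈ (Subgroup.zpowers (ι (FreeGroup.of 0))).topologicalClosure) (hy1 : y ≠ 1)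
    (hxy : Commute x y) :
    x ∈ (Subgroup.zpowers (ι (FreeGroup.of 0))).topologicalClosure := by
  have h := IsProSigmaCompletion.mem_closure_zpowers_of_commute (FreeGroupBasis.ofFreeGroup (Fin 2)) 0
    hι (x := x) (y := y)
  rw [FreeGroupBasis.ofFreeGroup_apply] at h
  exact h hy hy1 hxy

/-- **(H3), SELF term at the branch image `A = cl ⟨a⟩`**, `a = ι (of 0)`: `A ∩ x A x⁻¹ = 1` for every
`x ∉ A` (malnormality of the closed procyclic subgroup of a free basis element, tree's
`IsProSigmaCompletion.closure_zpowers_inf_conj_eq_bot`). [cite: MochizukiSemiAnbd2006, Def. 2.4(iv) p.26] -/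
theorem closure_zpowers_a_inf_conj_eq_bot (hι : IsProSigmaCompletion Sigma ι) {x : G}
    (hx : x ∉ (Subgroup.zpowers (ι (FreeGroup.of 0))).topologicalClosure) :
    (Subgroup.zpowers (ι (FreeGroup.of 0))).topologicalClosure ⊓
      ConjAct.toConjAct x • (Subgroup.zpowers (ι (FreeGroup.of 0))).topologicalClosure = ⊥ := by
  have h := IsProSigmaCompletion.closure_zpowers_inf_conj_eq_bot (FreeGroupBasis.ofFreeGroup (Fin 2)) 0
    hι (x := x)
  rw [FreeGroupBasis.ofFreeGroup_apply] at h
  exact h hx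

/-- The same at the other letter `b = ι (of 1)` (used at the vertex `v_0`-free end and by symmetry).
[cite: MochizukiSemiAnbd2006, Def. 2.4(iv) p.26] -/
theorem closure_zpowers_b_inf_conj_eq_bot (hι : IsProSigmaCompletion Sigma ι) {x : G}
    (hx : x ∉ (Subgroup.zpowers (ι (FreeGroup.of 1))).topologicalClosure) :
    (Subgroup.zpowers (ι (FreeGroup.of 1))).topologicalClosure ⊓
      ConjAct.toConjAct x • (Subgroup.zpowers (ι (FreeGroup.of 1))).topologicalClosure = ⊥ := by
  have h := IsProSigmaCompletion.closure_zpowers_inf_conj_eq_bot (FreeGroupBasis.ofFreeGroup (Fin 2)) 1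
    hι (x := x)
  rw [FreeGroupBasis.ofFreeGroup_apply] at h
  exact h hx

omit [T2Space G] in
/-- **Centraliser condition for `A_m = cl ⟨a·b^m⟩`** (`a·b^m = ι (of 0 * of 1 ^ m)`, a free basis element
by the Nielsen move): an element commuting with some `y ≠ 1` of `A_m` lies in `A_m`.
[cite: MochizukiSemiAnbd2006, Ex. 2.10 p.31] -/
theorem mem_closure_zpowers_aMulPow_of_commute (hι : IsProSigmaCompletion Sigma ι) (m : ℤ) {x y : G}
    (hy : y ∈ (Subgroup.zpowers (ι (FreeGroup.of 0 * FreeGroup.of 1 ^ m))).topologicalClosure)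
    (hy1 : y ≠ 1) (hxy : Commute x y) :
    x ∈ (Subgroup.zpowers (ι (FreeGroup.of 0 * FreeGroup.of 1 ^ m))).topologicalClosure := by
  obtain ⟨b, hb0, -⟩ := FreeTwo.exists_freeGroupBasis_mul_zpow m
  have h := IsProSigmaCompletion.mem_closure_zpowers_of_commute b 0 hι (x := x) (y := y)
  rw [hb0] at h
  exact h hy hy1 hxy

/-- **(H3), SELF term at the branch image `A_m = cl ⟨a·b^m⟩`** (`m = p^{n_k}` at the lower end of the edge
`e_k` of `𝒢_θ`): `A_m ∩ x A_m x⁻¹ = 1` for every `x ∉ A_m` — malnormality transported along the Nielsen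
basis `{a·b^m, b}`. [cite: MochizukiSemiAnbd2006, Def. 2.4(iv) p.26] -/
theorem closure_zpowers_aMulPow_inf_conj_eq_bot (hι : IsProSigmaCompletion Sigma ι) (m : ℤ) {x : G}
    (hx : x ∉ (Subgroup.zpowers (ι (FreeGroup.of 0 * FreeGroup.of 1 ^ m))).topologicalClosure) :
    (Subgroup.zpowers (ι (FreeGroup.of 0 * FreeGroup.of 1 ^ m))).topologicalClosure ⊓
      ConjAct.toConjAct x •
        (Subgroup.zpowers (ι (FreeGroup.of 0 * FreeGroup.of 1 ^ m))).topologicalClosure = ⊥ := by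
  obtain ⟨b, hb0, -⟩ := FreeTwo.exists_freeGroupBasis_mul_zpow m
  have h := IsProSigmaCompletion.closure_zpowers_inf_conj_eq_bot b 0 hι (x := x)
  rw [hb0] at h
  exact h hx

/-- `ℕ`-exponent form of the previous statement (`m = p ^ n`), the shape in which brick R3 writes the
lower gluing `1 ↦ a·b^{p^{n_k}}`. [cite: MochizukiSemiAnbd2006, Def. 2.4(iv) p.26] -/
theorem closure_zpowers_aMulPow_inf_conj_eq_bot' (hι : IsProSigmaCompletion Sigma ι) (m : ℕ) {x : G}
    (hx : x ∉ (Subgroup.zpowers (ι (FreeGroup.of 0 * FreeGroup.of 1 ^ m))).topologicalClosure) :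
    (Subgroup.zpowers (ι (FreeGroup.of 0 * FreeGroup.of 1 ^ m))).topologicalClosure ⊓
      ConjAct.toConjAct x •
        (Subgroup.zpowers (ι (FreeGroup.of 0 * FreeGroup.of 1 ^ m))).topologicalClosure = ⊥ := by
  have h := closure_zpowers_aMulPow_inf_conj_eq_bot hι (m : ℤ) (x := x)
  rw [zpow_natCast] at h
  exact h hx

/-- Contrapositive packaging (the form "a non-trivial intersection of a branch subgroup with a conjugate
forces the conjugator into it", used to derive `IsEstranged`'s same-branch clause): if
`A ⊓ x • A ≠ ⊥` then `x ∈ A`, for `A = cl ⟨ι (of 0 * of 1 ^ m)⟩`. [cite: MochizukiSemiAnbd2006, Def. 2.4(iv) p.26] -/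
theorem mem_closure_zpowers_aMulPow_of_inf_conj_ne_bot (hι : IsProSigmaCompletion Sigma ι) (m : ℤ)
    {x : G}
    (hx : (Subgroup.zpowers (ι (FreeGroup.of 0 * FreeGroup.of 1 ^ m))).topologicalClosure ⊓
      ConjAct.toConjAct x •
        (Subgroup.zpowers (ι (FreeGroup.of 0 * FreeGroup.of 1 ^ m))).topologicalClosure ≠ ⊥) :
    x ∈ (Subgroup.zpowers (ι (FreeGroup.of 0 * FreeGroup.of 1 ^ m))).topologicalClosure := by
  by_contra h
  exact hx (closure_zpowers_aMulPow_inf_conj_eq_bot hι m h)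

end Completion

end Literature.AnabelianGeometry.SemiGraphs
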